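import Literature.NumberTheory.NumberFields.CyclotomicFieldFourValuations
import Literature.NumberTheory.QuadraticFields.SqrtNegTwoFieldPrimes
import Mathlib.Tactic.NormNum.Prime
import HarnessLib

/-!
# The `ℚ(√−2)` valuation table of the `5`-descent of `E_{17/18}` over `ℚ(√−2)`: five places, six Kummer values

PROOF-ONLY file (theorems only, no definition, no named fact, no `sorry`), topic `NumberTheory/EllipticCurves`;
the arithmetic input of the instance `KubertTate1718SqrtNegTwoDescent` — the first complete `5`-descent over the
third quadratic field `ℚ(√−2)` (after the tree's descents over `ℚ(i)` and `ℚ(ζ₃)`), with SPLIT primes in `mn`.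
Carrier: any number field `K` with `[K : ℚ] = 2` and `θ ∈ K`, `θ² = −2` (tree `SqrtNegTwo.FieldData θ`), integers
`hK.ringEquiv ⟨a, b⟩ = a + bθ` (`𝓞 K = ℤ[√−2]`, tree `SqrtNegTwoFieldPrimes`).

`E = E_{17/18} = [1, -306, -5508, 0, 0]` (`kubertTateFive 17 18`; rank `2`, `t₅ = 0` over `ℚ`, tree `KubertTate1718ShaFive`),
`mn = 306 = 2·3²·17` with `3, 17 ≡ 3, 1 (mod 8)` SPLIT in `ℤ[√−2]` and `2 = −θ²` ramified: the five places of `K`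
above `mn` are `v₀ = (θ)`, `v₁ = (1 + θ)`, `v₂ = (1 − θ)`, `v₃ = (3 + 2θ)`, `v₄ = (3 − 2θ)` (`exists_places`; norms
`2, 3, 3, 17, 17`).  The six Kummer values `f_T = xy − 18x² + 324y` are those of the `ℚ`-points `−T = (0, 5508)`,
`P₁ = (-90, 4950)`, `P₂ = (216, 4320)` (`1784592`, `1012500`, `1492992`), of the two `K`-points
`R₁ = (-3723/4, (25755 + 184263θ)/8)`, `R₂ = (-1377/4, (23409 + 46818θ)/8)` (`(-561493629 − 447206301θ)/32`,
`(-70156773 − 3792258θ)/32`) — whose anti-invariant parts are the points `u = -3723/4`, `u = -1377/4` of the quadratic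
twist `-2Y² = 4u³ + b₂u² + 2b₄u + b₆` of `E` by `-2` (equivalently by `d_K = -8`) — and of the base point `2T = (306, 5202)`
(`1591812`).  Their `log`-valuations at the five places (Mathlib normalisation `log v = -ord_v`; the `K`-values carry the
denominator `32 = -θ¹⁰`):

  `log = [[-8,-8,-8,-1,-1], [-4,-4,-4,0,0], [-22,-6,-6,0,0], [10,-3,-2,-1,-4], [10,-8,-12,-3,-2]]`, base `[-4,-4,-4,-3,-3]`,

each certified by an explicit factorisation `α = πᵏ·y` in `ℤ[√−2]` with `y = π·z + d`, `ℓ ∤ d ∈ ℤ` (`ℓ = 2, 3, 17` the prime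
below), checked by `Zsqrtd` arithmetic.  The two `K`-rows DIFFER at the conjugate places `v₁ ≠ v₂`, `v₃ ≠ v₄` — what no
`ℚ`-point can do — which makes the `5 × 5` Kummer matrix invertible mod `5` (sequel `KubertTate1718SqrtNegTwoDescent`).
Instrument for stmt-BirchSwinnertonDyer-22356 («T»); BSD is not proved by this.

## References

* [SilvermanAEC2009] J. H. Silverman, *AEC*, 2nd ed., Exercise 10.1(c), Thm. X.1.1 (the descent values `f_T(P)` and their
  prime supports).
* [IrelandRosen1990] K. Ireland, M. Rosen, *A Classical Introduction to Modern Number Theory*, 2nd ed., Ch. 13 §1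
  (the primes of a quadratic field).
-/

noncomputable section

open scoped NumberField
open NumberField Ideal IsDedekindDomain Literature.NumberTheory.NumberFields Literature.NumberTheory.QuadraticFields

namespace Literature.NumberTheory.EllipticCurves

namespace KubertTate1718SqrtNegTwoDescent

variable {K : Type} [Field K] [NumberField K] {θ : K}

/-! ## §1 Arithmetic of `ℤ[√−2]` and the five places of `K` above `mn = 2·3²·17` -/

/-- Multiplication in `ℤ[√−2]`: `(a + bθ)(c + dθ) = (ac − 2bd) + (ad + bc)θ`. [cite: IrelandRosen1990, Ch. 13 §1] -/
private theorem zmul (a b c d : ℤ) : ((⟨a, b⟩ : ℤ√(-2)) * ⟨c, d⟩) = ⟨a * c - 2 * (b * d), a * d + b * c⟩ := by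
  ext
  · simp only [Zsqrtd.re_mul]; ring
  · simp only [Zsqrtd.im_mul]

/-- An element of `ℤ[√−2]` of prime norm gives a prime element of `𝓞 K` (tree `SqrtNegTwoPrimary.prime_of_norm_eq_prime`,
transported along `hK.ringEquiv`). [cite: IrelandRosen1990, Ch. 13 §1] -/
private theorem prime_ringEquiv (hK : SqrtNegTwo.FieldData θ) {z : ℤ√(-2)} {p : ℕ} (hp : p.Prime) (hz : z.norm = p) :
    Prime (hK.ringEquiv z) :=
  (MulEquiv.prime_iff hK.ringEquiv.toMulEquiv).mpr (SqrtNegTwoPrimary.prime_of_norm_eq_prime hp hz)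

/-- **The places `(θ)`, `(1 + θ)`, `(1 − θ)`, `(3 + 2θ)`, `(3 − 2θ)` of `K = ℚ(√−2)`** (prime elements of norms
`2, 3, 3, 17, 17`: `2 = −θ²` ramifies, `3 = (1 + θ)(1 − θ)` and `17 = (3 + 2θ)(3 − 2θ)` split). [cite: IrelandRosen1990, Ch. 13 §1] -/
theorem exists_places (hK : SqrtNegTwo.FieldData θ) :
    ∃ v₀ v₁ v₂ v₃ v₄ : HeightOneSpectrum (𝓞 K),
      v₀.asIdeal = span {hK.ringEquiv ⟨0, 1⟩} ∧ v₁.asIdeal = span {hK.ringEquiv ⟨1, 1⟩} ∧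
      v₂.asIdeal = span {hK.ringEquiv ⟨1, -1⟩} ∧ v₃.asIdeal = span {hK.ringEquiv ⟨3, 2⟩} ∧
      v₄.asIdeal = span {hK.ringEquiv ⟨3, -2⟩} := by
  have p₀ : Prime (hK.ringEquiv ⟨0, 1⟩) := prime_ringEquiv hK (p := 2) (by norm_num) (by decide)
  have p₁ : Prime (hK.ringEquiv ⟨1, 1⟩) := prime_ringEquiv hK (p := 3) (by norm_num) (by decide)
  have p₂ : Prime (hK.ringEquiv ⟨1, -1⟩) := prime_ringEquiv hK (p := 3) (by norm_num) (by decide)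
  have p₃ : Prime (hK.ringEquiv ⟨3, 2⟩) := prime_ringEquiv hK (p := 17) (by norm_num) (by decide)
  have p₄ : Prime (hK.ringEquiv ⟨3, -2⟩) := prime_ringEquiv hK (p := 17) (by norm_num) (by decide)
  obtain ⟨v₀, h₀⟩ := exists_asIdeal_eq_span p₀
  obtain ⟨v₁, h₁⟩ := exists_asIdeal_eq_span p₁
  obtain ⟨v₂, h₂⟩ := exists_asIdeal_eq_span p₂
  obtain ⟨v₃, h₃⟩ := exists_asIdeal_eq_span p₃
  obtain ⟨v₄, h₄⟩ := exists_asIdeal_eq_span p₄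
  exact ⟨v₀, v₁, v₂, v₃, v₄, h₀, h₁, h₂, h₃, h₄⟩

/-- The five generators are prime elements of `𝓞 K`. [cite: IrelandRosen1990, Ch. 13 §1] -/
theorem prime_gens (hK : SqrtNegTwo.FieldData θ) :
    Prime (hK.ringEquiv ⟨0, 1⟩) ∧ Prime (hK.ringEquiv ⟨1, 1⟩) ∧ Prime (hK.ringEquiv ⟨1, -1⟩) ∧
      Prime (hK.ringEquiv ⟨3, 2⟩) ∧ Prime (hK.ringEquiv ⟨3, -2⟩) :=
  ⟨prime_ringEquiv hK (p := 2) (by norm_num) (by decide), prime_ringEquiv hK (p := 3) (by norm_num) (by decide),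
    prime_ringEquiv hK (p := 3) (by norm_num) (by decide), prime_ringEquiv hK (p := 17) (by norm_num) (by decide),
    prime_ringEquiv hK (p := 17) (by norm_num) (by decide)⟩

/-! ## §2 The valuation table -/

section Table

variable (hK : SqrtNegTwo.FieldData θ) {v₀ v₁ v₂ v₃ v₄ : HeightOneSpectrum (𝓞 K)}
  (hv₀ : v₀.asIdeal = span {hK.ringEquiv ⟨0, 1⟩}) (hv₁ : v₁.asIdeal = span {hK.ringEquiv ⟨1, 1⟩})
  (hv₂ : v₂.asIdeal = span {hK.ringEquiv ⟨1, -1⟩}) (hv₃ : v₃.asIdeal = span {hK.ringEquiv ⟨3, 2⟩})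
  (hv₄ : v₄.asIdeal = span {hK.ringEquiv ⟨3, -2⟩})

include hv₀ hv₁ hv₂ hv₃ hv₄

/-- The rational primes `2, 3, 3, 17, 17` lie in the five places (`2 = θ·(−θ)`, `3 = (1 + θ)(1 − θ)`,
`17 = (3 + 2θ)(3 − 2θ)`). [cite: IrelandRosen1990, Ch. 13 §1] -/
theorem natCast_mem_places :
    ((2 : ℕ) : 𝓞 K) ∈ v₀.asIdeal ∧ ((3 : ℕ) : 𝓞 K) ∈ v₁.asIdeal ∧ ((3 : ℕ) : 𝓞 K) ∈ v₂.asIdeal ∧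
      ((17 : ℕ) : 𝓞 K) ∈ v₃.asIdeal ∧ ((17 : ℕ) : 𝓞 K) ∈ v₄.asIdeal := by
  refine ⟨?_, ?_, ?_, ?_, ?_⟩
  · rw [hv₀, mem_span_singleton]
    exact ⟨hK.ringEquiv ⟨0, -1⟩, by
      rw [← map_mul, show ((2 : ℕ) : 𝓞 K) = ((2 : ℤ) : 𝓞 K) by norm_cast, ← hK.ringEquiv_intCast]
      exact congrArg hK.ringEquiv (by decide)⟩
  · rw [hv₁, mem_span_singleton]
    exact ⟨hK.ringEquiv ⟨1, -1⟩, by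
      rw [← map_mul, show ((3 : ℕ) : 𝓞 K) = ((3 : ℤ) : 𝓞 K) by norm_cast, ← hK.ringEquiv_intCast]
      exact congrArg hK.ringEquiv (by decide)⟩
  · rw [hv₂, mem_span_singleton]
    exact ⟨hK.ringEquiv ⟨1, 1⟩, by
      rw [← map_mul, show ((3 : ℕ) : 𝓞 K) = ((3 : ℤ) : 𝓞 K) by norm_cast, ← hK.ringEquiv_intCast]
      exact congrArg hK.ringEquiv (by decide)⟩
  · rw [hv₃, mem_span_singleton]
    exact ⟨hK.ringEquiv ⟨3, -2⟩, by
      rw [← map_mul, show ((17 : ℕ) : 𝓞 K) = ((17 : ℤ) : 𝓞 K) by norm_cast, ← hK.ringEquiv_intCast]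
      exact congrArg hK.ringEquiv (by decide)⟩
  · rw [hv₄, mem_span_singleton]
    exact ⟨hK.ringEquiv ⟨3, 2⟩, by
      rw [← map_mul, show ((17 : ℕ) : 𝓞 K) = ((17 : ℤ) : 𝓞 K) by norm_cast, ← hK.ringEquiv_intCast]
      exact congrArg hK.ringEquiv (by decide)⟩


/-- **The orders of the five Kummer numerators at the five places**: `ord_{v_j}` of `1784592`, `1012500`, `1492992`
(`f_T` at `−T`, `P₁`, `P₂`), `-561493629 − 447206301θ`, `-70156773 − 3792258θ` (`32·f_T` at `R₁`, `R₂`) is the matrix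
`[[8, 8, 8, 1, 1], [4, 4, 4, 0, 0], [22, 6, 6, 0, 0], [0, 3, 2, 1, 4], [0, 8, 12, 3, 2]]` (read as `log v = -ord`), each entry an explicit factorisation in `ℤ[√−2]`.
[cite: SilvermanAEC2009, Exercise 10.1(c)] -/
theorem log_valuation_numerators : ∀ i j : Fin 5,
    WithZero.log ((![v₀, v₁, v₂, v₃, v₄] j).valuation K
      ((![(hK.ringEquiv ⟨1784592, 0⟩ : 𝓞 K), (hK.ringEquiv ⟨1012500, 0⟩ : 𝓞 K), (hK.ringEquiv ⟨1492992, 0⟩ : 𝓞 K), (hK.ringEquiv ⟨-561493629, -447206301⟩ : 𝓞 K), (hK.ringEquiv ⟨-70156773, -3792258⟩ : 𝓞 K)] i : 𝓞 K) : K)) =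
      -((![![8, 8, 8, 1, 1], ![4, 4, 4, 0, 0], ![22, 6, 6, 0, 0], ![0, 3, 2, 1, 4], ![0, 8, 12, 3, 2]] : Fin 5 → Fin 5 → ℕ) i j : ℤ) := by
  obtain ⟨hℓ₀, hℓ₁, hℓ₂, hℓ₃, hℓ₄⟩ := natCast_mem_places hK hv₀ hv₁ hv₂ hv₃ hv₄
  have hπ₀ : hK.ringEquiv ⟨0, 1⟩ ∈ v₀.asIdeal := by rw [hv₀]; exact mem_span_singleton_self _
  have hπ₁ : hK.ringEquiv ⟨1, 1⟩ ∈ v₁.asIdeal := by rw [hv₁]; exact mem_span_singleton_self _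
  have hπ₂ : hK.ringEquiv ⟨1, -1⟩ ∈ v₂.asIdeal := by rw [hv₂]; exact mem_span_singleton_self _
  have hπ₃ : hK.ringEquiv ⟨3, 2⟩ ∈ v₃.asIdeal := by rw [hv₃]; exact mem_span_singleton_self _
  have hπ₄ : hK.ringEquiv ⟨3, -2⟩ ∈ v₄.asIdeal := by rw [hv₄]; exact mem_span_singleton_self _

  have c00 : WithZero.log (v₀.valuation K ((hK.ringEquiv ⟨1784592, 0⟩ : 𝓞 K) : K)) = -8 := by
    rw [log_valuation_eq_neg_of_eq_pow_mul hv₀ 8 (y := hK.ringEquiv ⟨111537, 0⟩)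
      (by rw [← map_pow, ← map_mul]; exact congrArg hK.ringEquiv (by decide))
      (not_mem_of_eq_mul_add_intCast (ℓ := 2) (by norm_num) hℓ₀ hπ₀ (z := hK.ringEquiv ⟨0, -55768⟩) (d := 1)
        (by rw [← map_mul, ← hK.ringEquiv_intCast, ← map_add]; exact congrArg hK.ringEquiv (by decide)) (by norm_num))]
    norm_num
  have c01 : WithZero.log (v₁.valuation K ((hK.ringEquiv ⟨1784592, 0⟩ : 𝓞 K) : K)) = -8 := by
    rw [log_valuation_eq_neg_of_eq_pow_mul hv₁ 8 (y := hK.ringEquiv ⟨4624, -15232⟩)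
      (by rw [← map_pow, ← map_mul]; exact congrArg hK.ringEquiv (by decide))
      (not_mem_of_eq_mul_add_intCast (ℓ := 3) (by norm_num) hℓ₁ hπ₁ (z := hK.ringEquiv ⟨-8614, -6618⟩) (d := 2)
        (by rw [← map_mul, ← hK.ringEquiv_intCast, ← map_add]; exact congrArg hK.ringEquiv (by decide)) (by norm_num))]
    norm_num
  have c02 : WithZero.log (v₂.valuation K ((hK.ringEquiv ⟨1784592, 0⟩ : 𝓞 K) : K)) = -8 := by
    rw [log_valuation_eq_neg_of_eq_pow_mul hv₂ 8 (y := hK.ringEquiv ⟨4624, 15232⟩)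
      (by rw [← map_pow, ← map_mul]; exact congrArg hK.ringEquiv (by decide))
      (not_mem_of_eq_mul_add_intCast (ℓ := 3) (by norm_num) hℓ₂ hπ₂ (z := hK.ringEquiv ⟨-8614, 6618⟩) (d := 2)
        (by rw [← map_mul, ← hK.ringEquiv_intCast, ← map_add]; exact congrArg hK.ringEquiv (by decide)) (by norm_num))]
    norm_num
  have c03 : WithZero.log (v₃.valuation K ((hK.ringEquiv ⟨1784592, 0⟩ : 𝓞 K) : K)) = -1 := by
    rw [log_valuation_eq_neg_of_eq_pow_mul hv₃ 1 (y := hK.ringEquiv ⟨314928, -209952⟩)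
      (by rw [← map_pow, ← map_mul]; exact congrArg hK.ringEquiv (by decide))
      (not_mem_of_eq_mul_add_intCast (ℓ := 17) (by norm_num) hℓ₃ hπ₃ (z := hK.ringEquiv ⟨6174, -74100⟩) (d := 6)
        (by rw [← map_mul, ← hK.ringEquiv_intCast, ← map_add]; exact congrArg hK.ringEquiv (by decide)) (by norm_num))]
    norm_num
  have c04 : WithZero.log (v₄.valuation K ((hK.ringEquiv ⟨1784592, 0⟩ : 𝓞 K) : K)) = -1 := by
    rw [log_valuation_eq_neg_of_eq_pow_mul hv₄ 1 (y := hK.ringEquiv ⟨314928, 209952⟩)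
      (by rw [← map_pow, ← map_mul]; exact congrArg hK.ringEquiv (by decide))
      (not_mem_of_eq_mul_add_intCast (ℓ := 17) (by norm_num) hℓ₄ hπ₄ (z := hK.ringEquiv ⟨6174, 74100⟩) (d := 6)
        (by rw [← map_mul, ← hK.ringEquiv_intCast, ← map_add]; exact congrArg hK.ringEquiv (by decide)) (by norm_num))]
    norm_num
  have c10 : WithZero.log (v₀.valuation K ((hK.ringEquiv ⟨1012500, 0⟩ : 𝓞 K) : K)) = -4 := by
    rw [log_valuation_eq_neg_of_eq_pow_mul hv₀ 4 (y := hK.ringEquiv ⟨253125, 0⟩)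
      (by rw [← map_pow, ← map_mul]; exact congrArg hK.ringEquiv (by decide))
      (not_mem_of_eq_mul_add_intCast (ℓ := 2) (by norm_num) hℓ₀ hπ₀ (z := hK.ringEquiv ⟨0, -126562⟩) (d := 1)
        (by rw [← map_mul, ← hK.ringEquiv_intCast, ← map_add]; exact congrArg hK.ringEquiv (by decide)) (by norm_num))]
    norm_num
  have c11 : WithZero.log (v₁.valuation K ((hK.ringEquiv ⟨1012500, 0⟩ : 𝓞 K) : K)) = -4 := by
    rw [log_valuation_eq_neg_of_eq_pow_mul hv₁ 4 (y := hK.ringEquiv ⟨-87500, 50000⟩)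
      (by rw [← map_pow, ← map_mul]; exact congrArg hK.ringEquiv (by decide))
      (not_mem_of_eq_mul_add_intCast (ℓ := 3) (by norm_num) hℓ₁ hπ₁ (z := hK.ringEquiv ⟨4166, 45834⟩) (d := 2)
        (by rw [← map_mul, ← hK.ringEquiv_intCast, ← map_add]; exact congrArg hK.ringEquiv (by decide)) (by norm_num))]
    norm_num
  have c12 : WithZero.log (v₂.valuation K ((hK.ringEquiv ⟨1012500, 0⟩ : 𝓞 K) : K)) = -4 := by
    rw [log_valuation_eq_neg_of_eq_pow_mul hv₂ 4 (y := hK.ringEquiv ⟨-87500, -50000⟩)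
      (by rw [← map_pow, ← map_mul]; exact congrArg hK.ringEquiv (by decide))
      (not_mem_of_eq_mul_add_intCast (ℓ := 3) (by norm_num) hℓ₂ hπ₂ (z := hK.ringEquiv ⟨4166, -45834⟩) (d := 2)
        (by rw [← map_mul, ← hK.ringEquiv_intCast, ← map_add]; exact congrArg hK.ringEquiv (by decide)) (by norm_num))]
    norm_num
  have c13 : WithZero.log (v₃.valuation K ((hK.ringEquiv ⟨1012500, 0⟩ : 𝓞 K) : K)) = -0 := by
    rw [log_valuation_eq_neg_of_eq_pow_mul hv₃ 0 (y := hK.ringEquiv ⟨1012500, 0⟩)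
      (by rw [pow_zero, one_mul])
      (not_mem_of_eq_mul_add_intCast (ℓ := 17) (by norm_num) hℓ₃ hπ₃ (z := hK.ringEquiv ⟨178674, -119116⟩) (d := 14)
        (by rw [← map_mul, ← hK.ringEquiv_intCast, ← map_add]; exact congrArg hK.ringEquiv (by decide)) (by norm_num))]
    norm_num
  have c14 : WithZero.log (v₄.valuation K ((hK.ringEquiv ⟨1012500, 0⟩ : 𝓞 K) : K)) = -0 := by
    rw [log_valuation_eq_neg_of_eq_pow_mul hv₄ 0 (y := hK.ringEquiv ⟨1012500, 0⟩)
      (by rw [pow_zero, one_mul])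
      (not_mem_of_eq_mul_add_intCast (ℓ := 17) (by norm_num) hℓ₄ hπ₄ (z := hK.ringEquiv ⟨178674, 119116⟩) (d := 14)
        (by rw [← map_mul, ← hK.ringEquiv_intCast, ← map_add]; exact congrArg hK.ringEquiv (by decide)) (by norm_num))]
    norm_num
  have c20 : WithZero.log (v₀.valuation K ((hK.ringEquiv ⟨1492992, 0⟩ : 𝓞 K) : K)) = -22 := by
    rw [log_valuation_eq_neg_of_eq_pow_mul hv₀ 22 (y := hK.ringEquiv ⟨-729, 0⟩)
      (by rw [← map_pow, ← map_mul]; exact congrArg hK.ringEquiv (by decide))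
      (not_mem_of_eq_mul_add_intCast (ℓ := 2) (by norm_num) hℓ₀ hπ₀ (z := hK.ringEquiv ⟨0, 365⟩) (d := 1)
        (by rw [← map_mul, ← hK.ringEquiv_intCast, ← map_add]; exact congrArg hK.ringEquiv (by decide)) (by norm_num))]
    norm_num
  have c21 : WithZero.log (v₁.valuation K ((hK.ringEquiv ⟨1492992, 0⟩ : 𝓞 K) : K)) = -6 := by
    rw [log_valuation_eq_neg_of_eq_pow_mul hv₁ 6 (y := hK.ringEquiv ⟨47104, 20480⟩)
      (by rw [← map_pow, ← map_mul]; exact congrArg hK.ringEquiv (by decide))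
      (not_mem_of_eq_mul_add_intCast (ℓ := 3) (by norm_num) hℓ₁ hπ₁ (z := hK.ringEquiv ⟨29354, -8874⟩) (d := 2)
        (by rw [← map_mul, ← hK.ringEquiv_intCast, ← map_add]; exact congrArg hK.ringEquiv (by decide)) (by norm_num))]
    norm_num
  have c22 : WithZero.log (v₂.valuation K ((hK.ringEquiv ⟨1492992, 0⟩ : 𝓞 K) : K)) = -6 := by
    rw [log_valuation_eq_neg_of_eq_pow_mul hv₂ 6 (y := hK.ringEquiv ⟨47104, -20480⟩)
      (by rw [← map_pow, ← map_mul]; exact congrArg hK.ringEquiv (by decide))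
      (not_mem_of_eq_mul_add_intCast (ℓ := 3) (by norm_num) hℓ₂ hπ₂ (z := hK.ringEquiv ⟨29354, 8874⟩) (d := 2)
        (by rw [← map_mul, ← hK.ringEquiv_intCast, ← map_add]; exact congrArg hK.ringEquiv (by decide)) (by norm_num))]
    norm_num
  have c23 : WithZero.log (v₃.valuation K ((hK.ringEquiv ⟨1492992, 0⟩ : 𝓞 K) : K)) = -0 := by
    rw [log_valuation_eq_neg_of_eq_pow_mul hv₃ 0 (y := hK.ringEquiv ⟨1492992, 0⟩)
      (by rw [pow_zero, one_mul])
      (not_mem_of_eq_mul_add_intCast (ℓ := 17) (by norm_num) hℓ₃ hπ₃ (z := hK.ringEquiv ⟨263469, -175646⟩) (d := 1)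
        (by rw [← map_mul, ← hK.ringEquiv_intCast, ← map_add]; exact congrArg hK.ringEquiv (by decide)) (by norm_num))]
    norm_num
  have c24 : WithZero.log (v₄.valuation K ((hK.ringEquiv ⟨1492992, 0⟩ : 𝓞 K) : K)) = -0 := by
    rw [log_valuation_eq_neg_of_eq_pow_mul hv₄ 0 (y := hK.ringEquiv ⟨1492992, 0⟩)
      (by rw [pow_zero, one_mul])
      (not_mem_of_eq_mul_add_intCast (ℓ := 17) (by norm_num) hℓ₄ hπ₄ (z := hK.ringEquiv ⟨263469, 175646⟩) (d := 1)
        (by rw [← map_mul, ← hK.ringEquiv_intCast, ← map_add]; exact congrArg hK.ringEquiv (by decide)) (by norm_num))]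
    norm_num
  have c30 : WithZero.log (v₀.valuation K ((hK.ringEquiv ⟨-561493629, -447206301⟩ : 𝓞 K) : K)) = -0 := by
    rw [log_valuation_eq_neg_of_eq_pow_mul hv₀ 0 (y := hK.ringEquiv ⟨-561493629, -447206301⟩)
      (by rw [pow_zero, one_mul])
      (not_mem_of_eq_mul_add_intCast (ℓ := 2) (by norm_num) hℓ₀ hπ₀ (z := hK.ringEquiv ⟨-447206301, 280746815⟩) (d := 1)
        (by rw [← map_mul, ← hK.ringEquiv_intCast, ← map_add]; exact congrArg hK.ringEquiv (by decide)) (by norm_num))]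
    norm_num
  have c31 : WithZero.log (v₁.valuation K ((hK.ringEquiv ⟨-561493629, -447206301⟩ : 𝓞 K) : K)) = -3 := by
    rw [log_valuation_eq_neg_of_eq_pow_mul hv₁ 3 (y := hK.ringEquiv ⟨70853909, 103612042⟩)
      (by rw [← map_pow, ← map_mul]; exact congrArg hK.ringEquiv (by decide))
      (not_mem_of_eq_mul_add_intCast (ℓ := 3) (by norm_num) hℓ₁ hπ₁ (z := hK.ringEquiv ⟨92692664, 10919378⟩) (d := 1)
        (by rw [← map_mul, ← hK.ringEquiv_intCast, ← map_add]; exact congrArg hK.ringEquiv (by decide)) (by norm_num))]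
    norm_num
  have c32 : WithZero.log (v₂.valuation K ((hK.ringEquiv ⟨-561493629, -447206301⟩ : 𝓞 K) : K)) = -2 := by
    rw [log_valuation_eq_neg_of_eq_pow_mul hv₂ 2 (y := hK.ringEquiv ⟨261146537, -75086773⟩)
      (by rw [← map_pow, ← map_mul]; exact congrArg hK.ringEquiv (by decide))
      (not_mem_of_eq_mul_add_intCast (ℓ := 3) (by norm_num) hℓ₂ hπ₂ (z := hK.ringEquiv ⟨137106694, 62019921⟩) (d := 1)
        (by rw [← map_mul, ← hK.ringEquiv_intCast, ← map_add]; exact congrArg hK.ringEquiv (by decide)) (by norm_num))]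
    norm_num
  have c33 : WithZero.log (v₃.valuation K ((hK.ringEquiv ⟨-561493629, -447206301⟩ : 𝓞 K) : K)) = -1 := by
    rw [log_valuation_eq_neg_of_eq_pow_mul hv₃ 1 (y := hK.ringEquiv ⟨-204312123, -12860685⟩)
      (by rw [← map_pow, ← map_mul]; exact congrArg hK.ringEquiv (by decide))
      (not_mem_of_eq_mul_add_intCast (ℓ := 17) (by norm_num) hℓ₃ hπ₃ (z := hK.ringEquiv ⟨-39081126, 21767189⟩) (d := 11)
        (by rw [← map_mul, ← hK.ringEquiv_intCast, ← map_add]; exact congrArg hK.ringEquiv (by decide)) (by norm_num))]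
    norm_num
  have c34 : WithZero.log (v₄.valuation K ((hK.ringEquiv ⟨-561493629, -447206301⟩ : 𝓞 K) : K)) = -4 := by
    rw [log_valuation_eq_neg_of_eq_pow_mul hv₄ 4 (y := hK.ringEquiv ⟨2186451, 1375371⟩)
      (by rw [← map_pow, ← map_mul]; exact congrArg hK.ringEquiv (by decide))
      (not_mem_of_eq_mul_add_intCast (ℓ := 17) (by norm_num) hℓ₄ hπ₄ (z := hK.ringEquiv ⟨62226, 499941⟩) (d := 9)
        (by rw [← map_mul, ← hK.ringEquiv_intCast, ← map_add]; exact congrArg hK.ringEquiv (by decide)) (by norm_num))]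
    norm_num
  have c40 : WithZero.log (v₀.valuation K ((hK.ringEquiv ⟨-70156773, -3792258⟩ : 𝓞 K) : K)) = -0 := by
    rw [log_valuation_eq_neg_of_eq_pow_mul hv₀ 0 (y := hK.ringEquiv ⟨-70156773, -3792258⟩)
      (by rw [pow_zero, one_mul])
      (not_mem_of_eq_mul_add_intCast (ℓ := 2) (by norm_num) hℓ₀ hπ₀ (z := hK.ringEquiv ⟨-3792258, 35078387⟩) (d := 1)
        (by rw [← map_mul, ← hK.ringEquiv_intCast, ← map_add]; exact congrArg hK.ringEquiv (by decide)) (by norm_num))]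
    norm_num
  have c41 : WithZero.log (v₁.valuation K ((hK.ringEquiv ⟨-70156773, -3792258⟩ : 𝓞 K) : K)) = -8 := by
    rw [log_valuation_eq_neg_of_eq_pow_mul hv₁ 8 (y := hK.ringEquiv ⟨-246517, 588982⟩)
      (by rw [← map_pow, ← map_mul]; exact congrArg hK.ringEquiv (by decide))
      (not_mem_of_eq_mul_add_intCast (ℓ := 3) (by norm_num) hℓ₁ hπ₁ (z := hK.ringEquiv ⟨310482, 278500⟩) (d := 1)
        (by rw [← map_mul, ← hK.ringEquiv_intCast, ← map_add]; exact congrArg hK.ringEquiv (by decide)) (by norm_num))]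
    norm_num
  have c42 : WithZero.log (v₂.valuation K ((hK.ringEquiv ⟨-70156773, -3792258⟩ : 𝓞 K) : K)) = -12 := by
    rw [log_valuation_eq_neg_of_eq_pow_mul hv₂ 12 (y := hK.ringEquiv ⟨-49997, 58378⟩)
      (by rw [← map_pow, ← map_mul]; exact congrArg hK.ringEquiv (by decide))
      (not_mem_of_eq_mul_add_intCast (ℓ := 3) (by norm_num) hℓ₂ hπ₂ (z := hK.ringEquiv ⟨-55585, 2793⟩) (d := 2)
        (by rw [← map_mul, ← hK.ringEquiv_intCast, ← map_add]; exact congrArg hK.ringEquiv (by decide)) (by norm_num))]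
    norm_num
  have c43 : WithZero.log (v₃.valuation K ((hK.ringEquiv ⟨-70156773, -3792258⟩ : 𝓞 K) : K)) = -3 := by
    rw [log_valuation_eq_neg_of_eq_pow_mul hv₃ 3 (y := hK.ringEquiv ⟨583929, 577368⟩)
      (by rw [← map_pow, ← map_mul]; exact congrArg hK.ringEquiv (by decide))
      (not_mem_of_eq_mul_add_intCast (ℓ := 17) (by norm_num) hℓ₃ hπ₃ (z := hK.ringEquiv ⟨238896, 33192⟩) (d := 9)
        (by rw [← map_mul, ← hK.ringEquiv_intCast, ← map_add]; exact congrArg hK.ringEquiv (by decide)) (by norm_num))]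
    norm_num
  have c44 : WithZero.log (v₄.valuation K ((hK.ringEquiv ⟨-70156773, -3792258⟩ : 𝓞 K) : K)) = -2 := by
    rw [log_valuation_eq_neg_of_eq_pow_mul hv₄ 2 (y := hK.ringEquiv ⟨72171, -2926206⟩)
      (by rw [← map_pow, ← map_mul]; exact congrArg hK.ringEquiv (by decide))
      (not_mem_of_eq_mul_add_intCast (ℓ := 17) (by norm_num) hℓ₄ hπ₄ (z := hK.ringEquiv ⟨701253, -507900⟩) (d := 12)
        (by rw [← map_mul, ← hK.ringEquiv_intCast, ← map_add]; exact congrArg hK.ringEquiv (by decide)) (by norm_num))]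
    norm_num
  intro i j
  fin_cases i <;> fin_cases j
  · simpa using c00
  · simpa using c01
  · simpa using c02
  · simpa using c03
  · simpa using c04
  · simpa using c10
  · simpa using c11
  · simpa using c12
  · simpa using c13
  · simpa using c14
  · simpa using c20
  · simpa using c21
  · simpa using c22
  · simpa using c23
  · simpa using c24
  · simpa using c30
  · simpa using c31
  · simpa using c32
  · simpa using c33
  · simpa using c34
  · simpa using c40
  · simpa using c41
  · simpa using c42
  · simpa using c43
  · simpa using c44

/-- **The orders of the base value `f_T(2T) = 1591812 = 2²·3⁴·17³` at the five places**: `[4, 4, 4, 3, 3]`.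
[cite: SilvermanAEC2009, Exercise 10.1(c)] -/
theorem log_valuation_base : ∀ j : Fin 5,
    WithZero.log ((![v₀, v₁, v₂, v₃, v₄] j).valuation K (((hK.ringEquiv ⟨1591812, 0⟩ : 𝓞 K) : 𝓞 K) : K)) =
      -((![4, 4, 4, 3, 3] : Fin 5 → ℕ) j : ℤ) := by
  obtain ⟨hℓ₀, hℓ₁, hℓ₂, hℓ₃, hℓ₄⟩ := natCast_mem_places hK hv₀ hv₁ hv₂ hv₃ hv₄
  have hπ₀ : hK.ringEquiv ⟨0, 1⟩ ∈ v₀.asIdeal := by rw [hv₀]; exact mem_span_singleton_self _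
  have hπ₁ : hK.ringEquiv ⟨1, 1⟩ ∈ v₁.asIdeal := by rw [hv₁]; exact mem_span_singleton_self _
  have hπ₂ : hK.ringEquiv ⟨1, -1⟩ ∈ v₂.asIdeal := by rw [hv₂]; exact mem_span_singleton_self _
  have hπ₃ : hK.ringEquiv ⟨3, 2⟩ ∈ v₃.asIdeal := by rw [hv₃]; exact mem_span_singleton_self _
  have hπ₄ : hK.ringEquiv ⟨3, -2⟩ ∈ v₄.asIdeal := by rw [hv₄]; exact mem_span_singleton_self _

  have b00 : WithZero.log (v₀.valuation K ((hK.ringEquiv ⟨1591812, 0⟩ : 𝓞 K) : K)) = -4 := by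
    rw [log_valuation_eq_neg_of_eq_pow_mul hv₀ 4 (y := hK.ringEquiv ⟨397953, 0⟩)
      (by rw [← map_pow, ← map_mul]; exact congrArg hK.ringEquiv (by decide))
      (not_mem_of_eq_mul_add_intCast (ℓ := 2) (by norm_num) hℓ₀ hπ₀ (z := hK.ringEquiv ⟨0, -198976⟩) (d := 1)
        (by rw [← map_mul, ← hK.ringEquiv_intCast, ← map_add]; exact congrArg hK.ringEquiv (by decide)) (by norm_num))]
    norm_num
  have b01 : WithZero.log (v₁.valuation K ((hK.ringEquiv ⟨1591812, 0⟩ : 𝓞 K) : K)) = -4 := by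
    rw [log_valuation_eq_neg_of_eq_pow_mul hv₁ 4 (y := hK.ringEquiv ⟨-137564, 78608⟩)
      (by rw [← map_pow, ← map_mul]; exact congrArg hK.ringEquiv (by decide))
      (not_mem_of_eq_mul_add_intCast (ℓ := 3) (by norm_num) hℓ₁ hπ₁ (z := hK.ringEquiv ⟨6550, 72058⟩) (d := 2)
        (by rw [← map_mul, ← hK.ringEquiv_intCast, ← map_add]; exact congrArg hK.ringEquiv (by decide)) (by norm_num))]
    norm_num
  have b02 : WithZero.log (v₂.valuation K ((hK.ringEquiv ⟨1591812, 0⟩ : 𝓞 K) : K)) = -4 := by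
    rw [log_valuation_eq_neg_of_eq_pow_mul hv₂ 4 (y := hK.ringEquiv ⟨-137564, -78608⟩)
      (by rw [← map_pow, ← map_mul]; exact congrArg hK.ringEquiv (by decide))
      (not_mem_of_eq_mul_add_intCast (ℓ := 3) (by norm_num) hℓ₂ hπ₂ (z := hK.ringEquiv ⟨6550, -72058⟩) (d := 2)
        (by rw [← map_mul, ← hK.ringEquiv_intCast, ← map_add]; exact congrArg hK.ringEquiv (by decide)) (by norm_num))]
    norm_num
  have b03 : WithZero.log (v₃.valuation K ((hK.ringEquiv ⟨1591812, 0⟩ : 𝓞 K) : K)) = -3 := by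
    rw [log_valuation_eq_neg_of_eq_pow_mul hv₃ 3 (y := hK.ringEquiv ⟨-14580, -12312⟩)
      (by rw [← map_pow, ← map_mul]; exact congrArg hK.ringEquiv (by decide))
      (not_mem_of_eq_mul_add_intCast (ℓ := 17) (by norm_num) hℓ₃ hπ₃ (z := hK.ringEquiv ⟨-5472, -456⟩) (d := 12)
        (by rw [← map_mul, ← hK.ringEquiv_intCast, ← map_add]; exact congrArg hK.ringEquiv (by decide)) (by norm_num))]
    norm_num
  have b04 : WithZero.log (v₄.valuation K ((hK.ringEquiv ⟨1591812, 0⟩ : 𝓞 K) : K)) = -3 := by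
    rw [log_valuation_eq_neg_of_eq_pow_mul hv₄ 3 (y := hK.ringEquiv ⟨-14580, 12312⟩)
      (by rw [← map_pow, ← map_mul]; exact congrArg hK.ringEquiv (by decide))
      (not_mem_of_eq_mul_add_intCast (ℓ := 17) (by norm_num) hℓ₄ hπ₄ (z := hK.ringEquiv ⟨-5472, 456⟩) (d := 12)
        (by rw [← map_mul, ← hK.ringEquiv_intCast, ← map_add]; exact congrArg hK.ringEquiv (by decide)) (by norm_num))]
    norm_num
  intro j
  fin_cases j
  · simpa using b00
  · simpa using b01
  · simpa using b02
  · simpa using b03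
  · simpa using b04

end Table

end KubertTate1718SqrtNegTwoDescent

end Literature.NumberTheory.EllipticCurves

end
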